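import Literature.Analysis.FluidPDE.TaoCascadeReducedClaim
import Literature.Analysis.FluidPDE.TaoCascadeRescaledExit
import HarnessLib

/-!
# Tao's cascade ODE, §6.5: Cor. 6.11 in the regime, and Prop. 6.5 ⇐ Prop. 6.12 outright

T. Tao, *Finite time blowup for an averaged three-dimensional Navier–Stokes equation*,
J. Amer. Math. Soc. 29 (2016), 601–674 = arXiv:1402.0290v3, §6.5 Cor. 6.11 and the paragraph after
Prop. 6.12 (equation numbers of arXiv v3).

`TaoCascadeReducedClaim.lean` reduced the corrected Prop. 6.5 (`rescaledStepCorrected'`) to Prop. 6.12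
(`reducedClaimCorrected`) plus one remaining input, Cor. 6.11 at the maximal time `T₁` in the regime.
That input is now supplied by `RescaledHypotheses.exit_trichotomy` (`TaoCascadeRescaledExit.lean`,
Lemmas 6.9–6.10 and Cor. 6.11, proved under the explicit largeness hypotheses `10⁸ ≤ ε₀ K⁴`, `ε ≤ 1`,
`C₂ (1+ε₀)^{-n₀/2} cumEnergyConst ε₀ C₃ ≤ 1/100`); this file discharges those hypotheses with the
`InRegime` calculus (`exitTrichotomy_T1_inRegime`) and records the clean statements
`rescaledStepWith'_of_reducedClaimWith` (`γ(K) ≤ 10⁻⁵`) and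
`rescaledStepCorrected'_of_reducedClaimCorrected : reducedClaimCorrected → rescaledStepCorrected'`.
Theorems only.

## References

* T. Tao, J. Amer. Math. Soc. 29 (2016), 601–674 = arXiv:1402.0290v3, §6.5 Cor. 6.11, Prop. 6.12 and
  the paragraph following it. [`Tao2016AveragedNS`]
-/

noncomputable section

open Set Filter
open scoped _root_.Topology

namespace Literature.Analysis.FluidPDE

namespace TaoCascade

open Literature.Analysis.ODE

/-- `10⁸ ≤ ε₀ K⁴` for `K` large (`ε₀ > 0`). [folklore] -/
theorem eventually_le_eps_mul_pow_four {ε₀ : ℝ} (hε₀ : 0 < ε₀) :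
    ∀ᶠ K : ℝ in atTop, (10 : ℝ) ^ 8 ≤ ε₀ * K ^ 4 := by
  have h : Tendsto (fun K : ℝ => ε₀ * K ^ 4) atTop atTop :=
    (tendsto_pow_atTop (by norm_num : (4 : ℕ) ≠ 0)).const_mul_atTop hε₀
  exact h.eventually_ge_atTop _

/-- **Cor. 6.11 at `T₁` in the regime of Prop. 6.5**, for every `X₃`-coefficient `γ(K) ≤ 10⁻⁵`: the
largeness hypotheses of `RescaledHypotheses.exit_trichotomy` hold for `K` large (depending on `ε₀`),
`ε ≤ 1`, and `n₀` large (depending on `ε₀, C₂, C₃`). [cite: Tao2016AveragedNS, §6.5 Cor. 6.11] -/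
theorem exitTrichotomy_T1_inRegime {γ : ℝ → ℝ} (hγ : ∀ K, 0 < K → γ K ≤ 1 / 10 ^ 5) :
    InRegime γ fun D => ExitTrichotomy D.ε₀ D.K D.Y D.F (T1 D.ε₀ D.K D.Y D.F) := by
  have hKε : InRegime γ fun D => (10 : ℝ) ^ 8 ≤ D.ε₀ * D.K ^ 4 :=
    InRegime.of_K (p := fun ε₀ _ K => (10 : ℝ) ^ 8 ≤ ε₀ * K ^ 4) fun ε₀ _ hε₀ _ _ =>
      eventually_le_eps_mul_pow_four hε₀
  have hε : InRegime γ fun D => D.ε ≤ 1 := by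
    refine InRegime.of_eps (p := fun _ _ _ ε => ε ≤ 1) fun _ _ _ _ _ _ _ => ?_
    have : Iio (1 : ℝ) ∈ 𝓝[>] (0 : ℝ) := mem_nhdsWithin_of_mem_nhds (Iio_mem_nhds (by norm_num))
    exact Filter.mem_of_superset this fun ε (hε : ε < 1) => (le_of_lt hε : ε ≤ 1)
  have hn : InRegime γ fun D =>
      D.C₂ * cumEnergyConst D.ε₀ D.C₃ * (1 + D.ε₀) ^ (-(D.n₀ : ℝ) / 2) ≤ 1 / 100 := by
    refine InRegime.of_n0
      (p := fun ε₀ _ _ _ C₂ C₃ n₀ => C₂ * cumEnergyConst ε₀ C₃ * (1 + ε₀) ^ (-(n₀ : ℝ) / 2) ≤ 1 / 100)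
      fun ε₀ K ε C₁ C₂ C₃ hε₀ _ _ _ _ _ _ => ?_
    exact eventually_mul_rpow_neg_half_le hε₀ _ (by norm_num)
  refine ((hKε.and hε).and hn).mono ?_
  rintro D hD ⟨⟨hKεD, hεD⟩, hnD⟩
  have hn' : D.C₂ * (1 + D.ε₀) ^ (-(D.n₀ : ℝ) / 2) * cumEnergyConst D.ε₀ D.C₃ ≤ 1 / 100 := by
    calc D.C₂ * (1 + D.ε₀) ^ (-(D.n₀ : ℝ) / 2) * cumEnergyConst D.ε₀ D.C₃
        = D.C₂ * cumEnergyConst D.ε₀ D.C₃ * (1 + D.ε₀) ^ (-(D.n₀ : ℝ) / 2) := by ring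
      _ ≤ 1 / 100 := hnD
  have h := hD.hyp.exit_trichotomy hD.ε₀_pos hD.ε₀_lt_one (hγ D.K hD.K_pos) hD.K_pos hKεD hD.ε_pos
    hεD hD.C₂_nonneg hD.C₃_nonneg hD.n₀_le_N hn'
  -- the exponent `2/10` of `exit_trichotomy` is the `1/5` of `ExitTrichotomy`
  have e : ((2 : ℝ) / 10) = (1 : ℝ) / 5 := by norm_num
  rw [e] at h
  exact h

/-- **Prop. 6.5 (`C₃` before `K₀`) from Prop. 6.12 alone**, for every coefficient `γ(K) ≤ 10⁻⁵`
(Cor. 6.11 being now proved). [cite: Tao2016AveragedNS, §6.5, paragraph after Prop. 6.12] -/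
theorem rescaledStepWith'_of_reducedClaimWith {γ : ℝ → ℝ} (hγ : ∀ K, 0 < K → γ K ≤ 1 / 10 ^ 5)
    (h12 : reducedClaimWith γ) : rescaledStepWith' γ :=
  rescaledStepWith'_of_reducedClaim hγ (exitTrichotomy_T1_inRegime hγ) h12

/-- **The corrected Prop. 6.5 from the corrected Prop. 6.12**: `reducedClaimCorrected →
rescaledStepCorrected'`. [cite: Tao2016AveragedNS, §6.5, paragraph after Prop. 6.12] -/
theorem rescaledStepCorrected'_of_reducedClaimCorrected (h12 : reducedClaimCorrected) :
    rescaledStepCorrected' := by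
  refine rescaledStepWith'_of_reducedClaimWith (fun K _ => ?_) h12
  have h1 : Real.exp (-K ^ 10 / 2) ≤ 1 := Real.exp_le_one_iff.2 (by
    have : 0 ≤ K ^ 10 := by positivity
    linarith)
  have h2 : 0 ≤ Real.exp (-K ^ 10 / 2) := (Real.exp_pos _).le
  nlinarith

/-- **The bootstrap time `T₁` exists in the regime** (`IsBootstrapTime` at `T1`), for every
`γ(K) ≤ 10⁻⁵`: Lemma 6.8, Cor. 6.11 and `T₁ > 0` combined.
[cite: Tao2016AveragedNS, §6.5 Cor. 6.11] -/
theorem isBootstrapTime_T1_inRegime {γ : ℝ → ℝ} (hγ : ∀ K, 0 < K → γ K ≤ 1 / 10 ^ 5) :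
    InRegime γ fun D => IsBootstrapTime D.ε₀ D.K D.Y D.F (T1 D.ε₀ D.K D.Y D.F) := by
  have hK : InRegime γ fun D => 2 ≤ D.K :=
    InRegime.of_K (p := fun _ _ K => 2 ≤ K) fun _ _ _ _ _ => eventually_ge_atTop 2
  refine (((goodAt_zero_inRegime hγ).and (exitTrichotomy_T1_inRegime hγ)).and hK).mono ?_
  rintro D hD ⟨⟨h0, h11⟩, hKD⟩
  exact hD.hyp.isBootstrapTime_T1 hD.ε₀_pos hKD hD.n₀_le_N h0 h11

end TaoCascade

end Literature.Analysis.FluidPDE
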